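import Summits.QuantumAdvantage.AdviceFreeQNC0.CounterStrategies
import Summits.QuantumAdvantage.AdviceFreeQNC0.AffBells22SubcubeWalk
import HarnessLib
import Summits.QuantumAdvantage.QuantumAdvantage.Theorems.CharDialCounterSubcubeA

/-!
# R13⊕ — counter strategies with a deterministic ALIEN-TOGGLE SCHEDULE, on subcubes (decomp-qadv lens-6 g13, tree part 24 = the E3 «promise deferral» kernel, PROVED)

The 12p-state process of `CounterProcess` (register `V₄`, label `ℤ/3`, counter `ℤ/p`; cut `t` fires through the table
`tabN p y t` of the counter) with ONE modification: the bit step at position `t` with bit value `1` additionally toggles the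
register by a prescribed `τ t ∈ V₄` (an «alien» toggle, independent of the label).  On the subcube `{u_W = b_W}` with
`m = n − |W|` free positions, for every column `κ`, the final `(register, label)` lies OUTSIDE the LOSE member `L_{(κ,0)}` of
the translate family for at most `(2/3 + 4p·√(12p/(m+1)))·2ⁿ` merged inputs (`schedSubcube_sharp`, `3 ∤ p`).
PROOF = part 22 (`Theorems/CharDialCounterSubcube.lean`) with three changes: the free step is the average of the bijections
`bitEq false` and `togSt (τ t) ∘ bitEq true` (`lawT_succ_free`), so the `L²` decrement is the defect `D2T (τ t)` w.r.t.
`RT τ = togSt τ ∘ shK 1` (`Q_lawT_succ_free`); `Φ` is monotone because it is invariant under GLOBAL alien toggles (`phi_togSt`, from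
the closure of `𝓛` under alien toggles, `mem_alienIdx`); and the good-time bound averages over `RT^{2p} = shK 2p`, `RT^{4p} = shK 4p ≡ shK p`
(`l1_lam_le_T : ‖μ − λ̃‖₁ ≤ 2p·D1T`).  WHY (E3 «promise deferral»): a cut of the walk game that reads ONE input bit the walk has not yet
consumed only PROMISES the register toggle `τ`; deferring it to the bit's consumption gives exactly this process.  WHAT THIS IS NOT: the
reduction «junta ⊕ prefix-form strategies with future one-reads on a subcube = this process» (`JLinPeel.PrefixFutureReadHard p`) is NOT in this
file (g14; blueprint `g14probe/E3-BLUEPRINT.md` §1); cuts reading bits consumed long ago (memory) are not covered by any schedule.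
THEOREM: `schedSubcube_sharp` (kernel-closed: propext, Classical.choice, Quot.sound); independent of parts 21–23.
-/

namespace Summit.QuantumAdvantage.AdviceFreeQNC0

open Finset AffBells22

namespace CounterLaw

/-! ## §1 Alien toggles: `V₄` acting on the register, and the closure of `𝓛` -/

section Alien

/-- componentwise XOR on `V₄ = Bool × Bool`. -/
def bx (r s : Bool × Bool) : Bool × Bool := (xor r.1 s.1, xor r.2 s.2)

/-- CharDialSchedCounterSubcubeA helper `bx_zero` (decomp-qadv land package; see the module docstring). -/
@[simp] theorem bx_zero (r : Bool × Bool) : bx r (false, false) = r := by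
  rcases r with ⟨a, b⟩; simp [bx]

/-- CharDialSchedCounterSubcubeA helper `bx_bx` (decomp-qadv land package; see the module docstring). -/
theorem bx_bx (r s : Bool × Bool) : bx (bx r s) s = r := by
  rcases r with ⟨a, b⟩; rcases s with ⟨c, d⟩; simp [bx]

/-- a genuine fire toggle is an alien toggle: `tog a' r = bx r (e a')`. -/
theorem tog_eq_bx (a' : ZMod 3) (r : Bool × Bool) : tog a' r = bx r (decide (a' ≠ 0), decide (a' ≠ 1)) := by
  revert a' r; decide

/-- every nonzero element of `V₄` is some `e a'`. -/
theorem exists_tog_of_ne_zero : ∀ s : Bool × Bool, s ≠ (false, false) → ∃ a' : ZMod 3, ∀ r, bx r s = tog a' r := by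
  decide

/-- the alien toggle of an index: `(tog a' g, a) ∈ L_i ⟺ (g, a) ∈ L_{alienIdx a' i}` (`a'` independent of the label `a`). -/
def alienIdx (a' : ZMod 3) (i : Idx) : Idx :=
  match i.2 with
  | none => (i.1, some (i.1 - a'))
  | some r => if r = i.1 - a' then (i.1, none) else (i.1, some (2 * r + 2 * (i.1 - a')))

/-- **alien toggles act on `𝓛`.** -/
theorem mem_alienIdx (a' : ZMod 3) (i : Idx) (g : Bool × Bool) (a : ZMod 3) :
    mem (alienIdx a' i) g a = mem i (tog a' g) a := by
  revert a' i g a; decide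

/-- CharDialSchedCounterSubcubeA helper `alienIdx_alienIdx` (decomp-qadv land package; see the module docstring). -/
theorem alienIdx_alienIdx (a' : ZMod 3) (i : Idx) : alienIdx a' (alienIdx a' i) = i := by
  revert a' i; decide

/-- hence a permutation of `Idx`. -/
def alienEquiv (a' : ZMod 3) : Idx ≃ Idx := Function.Involutive.toPerm (alienIdx a') (alienIdx_alienIdx a')

variable {p : ℕ}

/-- alien-toggle invariance of the masses. -/
theorem mass_alienTog (μ : St p → ℝ) (a' : ZMod 3) (i : Idx) (b : ZMod p) :
    mass (fun x => μ (tog a' x.1, x.2.1, x.2.2)) i b = mass μ (alienIdx a' i) b := by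
  unfold mass
  refine sum_comm.trans ((sum_congr rfl fun a _ => ?_).trans sum_comm)
  rw [← Equiv.sum_comp (Function.Involutive.toPerm (tog a') (tog_tog a'))
    (fun g => if mem (alienIdx a' i) g a = true then μ (g, a, b) else 0)]
  refine sum_congr rfl fun g _ => ?_
  simp only [Function.Involutive.coe_toPerm, mem_alienIdx, tog_tog]

/-- **`Φ` is invariant under a GLOBAL alien toggle** of the register. -/
theorem phi_togSt [NeZero p] (μ : St p → ℝ) (s : Bool × Bool) :
    phi (fun x => μ (bx x.1 s, x.2.1, x.2.2)) = phi μ := by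
  by_cases hs : s = (false, false)
  · subst hs; simp only [bx_zero]
  · obtain ⟨a', ha'⟩ := exists_tog_of_ne_zero s hs
    simp only [ha']
    unfold phi
    refine sum_congr rfl fun b _ => ?_
    simp only [mass_alienTog]
    exact inf'_comp_equiv ⟨(0, none), mem_univ _⟩ (alienEquiv a') (fun i => mass μ i b)

variable (p)

/-- the alien toggle as a permutation of the state space. -/
def togSt (s : Bool × Bool) : St p ≃ St p where
  toFun x := (bx x.1 s, x.2.1, x.2.2)
  invFun x := (bx x.1 s, x.2.1, x.2.2)
  left_inv x := by simp [bx_bx]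
  right_inv x := by simp [bx_bx]

/-- CharDialSchedCounterSubcubeA helper `togSt_apply` (decomp-qadv land package; see the module docstring). -/
theorem togSt_apply (s : Bool × Bool) (x : St p) : togSt p s x = (bx x.1 s, x.2.1, x.2.2) := rfl

/-- CharDialSchedCounterSubcubeA helper `togSt_symm_apply` (decomp-qadv land package; see the module docstring). -/
theorem togSt_symm_apply (s : Bool × Bool) (x : St p) : (togSt p s).symm x = (bx x.1 s, x.2.1, x.2.2) := rfl

/-- the defect map of the scheduled free step: `RT s = togSt s ∘ shK 1`, `(RT s)⁻¹ x = (x.reg ⊕ s, lab − 1, ctr − 1)`. -/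
def RT (s : Bool × Bool) : St p ≃ St p := (shK p 1).trans (togSt p s)

/-- CharDialSchedCounterSubcubeA helper `RT_symm_apply` (decomp-qadv land package; see the module docstring). -/
theorem RT_symm_apply (s : Bool × Bool) (x : St p) : (RT p s).symm x = (bx x.1 s, x.2.1 - 1, x.2.2 - 1) := by
  simp [RT, togSt_symm_apply, shK_symm_apply]

/-- `(RT s)² = shK 2`: the toggles cancel in pairs. -/
theorem RT_sq (s : Bool × Bool) : (RT p s) ^ 2 = shK p 2 := by
  ext x <;> simp [RT, pow_two, Equiv.Perm.mul_def, togSt_apply, shK, bx_bx] <;> ring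

/-- even powers of `RT s` are pure shifts: `(RT s)^(2k) = shK (2k)`. -/
theorem RT_pow_even (s : Bool × Bool) (k : ℕ) : (RT p s) ^ (2 * k) = shK p (2 * k) := by
  rw [pow_mul, RT_sq, shK_eq_pow p (2 * k), pow_mul, ← shK_eq_pow p 2]

variable [NeZero p]

/-- `ℓ¹` defect of `μ` under `RT s`. -/
noncomputable def D1T (s : Bool × Bool) (μ : St p → ℝ) : ℝ := l1 μ (fun x => μ ((RT p s).symm x))

/-- `ℓ²` defect of `μ` under `RT s`. -/
noncomputable def D2T (s : Bool × Bool) (μ : St p → ℝ) : ℝ := ∑ x, (μ x - μ ((RT p s).symm x)) ^ 2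

/-- CharDialSchedCounterSubcubeA helper `D1T_nonneg` (decomp-qadv land package; see the module docstring). -/
theorem D1T_nonneg (s : Bool × Bool) (μ : St p → ℝ) : 0 ≤ D1T p s μ := l1_nonneg _ _

/-- CharDialSchedCounterSubcubeA helper `D2T_nonneg` (decomp-qadv land package; see the module docstring). -/
theorem D2T_nonneg (s : Bool × Bool) (μ : St p → ℝ) : 0 ≤ D2T p s μ := sum_nonneg fun _ _ => sq_nonneg _

/-- Cauchy–Schwarz: `D1T² ≤ 12p·D2T`. -/
theorem sq_D1T_le (s : Bool × Bool) (μ : St p → ℝ) : D1T p s μ ^ 2 ≤ 12 * p * D2T p s μ := by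
  have h := sq_l1_le μ (fun x => μ ((RT p s).symm x))
  rw [card_St] at h
  simpa [D1T, D2T] using h

/-- **`‖μ − λ̃‖₁ ≤ 2p·D1T`**: the label average `λ̃` of `CounterStrategies` is reached by the EVEN iterates `RT^{4p} ≡ shK p`,
`RT^{2p} = shK 2p`. -/
theorem l1_lam_le_T (s : Bool × Bool) (μ : St p → ℝ) : l1 μ (lam p μ) ≤ 2 * p * D1T p s μ := by
  have hk : ∀ k : ℕ, l1 μ (fun x => μ ((shK p (2 * k)).symm x)) ≤ (2 * k : ℕ) * D1T p s μ := by
    intro k; rw [← RT_pow_even p s k]; exact l1_iterate_le (RT p s) μ (2 * k)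
  -- `shK (4p)` and `shK p` agree pointwise
  have h4 : ∀ x : St p, μ ((shK p (2 * (2 * p))).symm x) = μ ((shK p p).symm x) := by
    intro x
    simp only [shK_symm_apply]
    have h3 : ((3 * p : ℕ) : ZMod 3) = 0 := by rw [ZMod.natCast_eq_zero_iff]; exact dvd_mul_right 3 p
    have e3 : x.2.1 - ((2 * (2 * p) : ℕ) : ZMod 3) = x.2.1 - ((p : ℕ) : ZMod 3) := by
      have e : ((2 * (2 * p) : ℕ) : ZMod 3) = ((3 * p : ℕ) : ZMod 3) + (p : ZMod 3) := by push_cast; ring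
      rw [e, h3, zero_add]
    have ep : x.2.2 - ((2 * (2 * p) : ℕ) : ZMod p) = x.2.2 - ((p : ℕ) : ZMod p) := by
      have hp : ((p : ℕ) : ZMod p) = 0 := ZMod.natCast_self p
      push_cast; rw [hp]; ring
    rw [e3, ep]
  have h1 : l1 μ (fun x => μ ((shK p p).symm x)) ≤ (2 * (2 * p) : ℕ) * D1T p s μ := by
    have := hk (2 * p)
    have e : (fun x => μ ((shK p (2 * (2 * p))).symm x)) = fun x => μ ((shK p p).symm x) := funext h4
    rwa [e] at this
  have h2 : l1 μ (fun x => μ ((shK p (2 * p)).symm x)) ≤ (2 * p : ℕ) * D1T p s μ := hk p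
  have hsum : l1 μ (lam p μ) ≤ (l1 μ (fun x => μ ((shK p p).symm x)) + l1 μ (fun x => μ ((shK p (2 * p)).symm x))) / 3 := by
    unfold l1
    rw [← sum_add_distrib, sum_div]
    refine sum_le_sum fun x _ => ?_
    dsimp only
    unfold lam
    rw [le_div_iff₀ (by norm_num : (0 : ℝ) < 3)]
    have : |μ x - (μ x + μ ((shK p p).symm x) + μ ((shK p (2 * p)).symm x)) / 3| * 3
        = |(μ x - μ ((shK p p).symm x)) + (μ x - μ ((shK p (2 * p)).symm x))| := by
      rw [← abs_of_pos (by norm_num : (0 : ℝ) < 3), ← abs_mul]; congr 1; ring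
    rw [this]; exact abs_add_le _ _
  push_cast at h1 h2
  linarith

omit [NeZero p] in
/-- masses are linear: the mass of an average. -/
theorem mass_avg (f g : St p → ℝ) (i : Idx) (b : ZMod p) :
    mass (fun x => (f x + g x) / 2) i b = (mass f i b + mass g i b) / 2 := by
  unfold mass
  rw [← sum_add_distrib, sum_div]
  refine sum_congr rfl fun g' _ => ?_
  rw [← sum_add_distrib, sum_div]
  refine sum_congr rfl fun a _ => ?_
  split_ifs <;> ring

/-- `Φ` is midpoint-concave... rather SUPERADDITIVE at averages: `(Φ f + Φ g)/2 ≤ Φ((f+g)/2)`. -/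
theorem phi_avg_le (f g : St p → ℝ) : (phi f + phi g) / 2 ≤ phi (fun x => (f x + g x) / 2) := by
  unfold phi
  rw [← sum_add_distrib, sum_div]
  refine sum_le_sum fun b _ => ?_
  refine Finset.le_inf' _ _ fun i _ => ?_
  rw [mass_avg]
  have h1 := inf'_le (fun i => mass f i b) (mem_univ i)
  have h2 := inf'_le (fun i => mass g i b) (mem_univ i)
  linarith

/-- **`Φ` does not decrease at a scheduled free step** (average of the two bijections `bitEq false`, `togSt s ∘ bitEq true`). -/
theorem phi_bitT_le (μ : St p → ℝ) (s : Bool × Bool) :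
    phi μ ≤ phi (fun x : St p => (μ (x.1, x.2.1 - 1, x.2.2) + μ (bx x.1 s, x.2.1 - 2, x.2.2 - 1)) / 2) := by
  have hf : phi (fun x : St p => μ (x.1, x.2.1 - 1, x.2.2)) = phi μ := by
    have := phi_shift_eq (p := p) μ 1 0
    simpa using this
  have hg : phi (fun x : St p => μ (bx x.1 s, x.2.1 - 2, x.2.2 - 1)) = phi μ := by
    rw [← phi_togSt μ s]
    exact phi_shift_eq (p := p) (fun z : St p => μ (bx z.1 s, z.2.1, z.2.2)) 2 1
  have := phi_avg_le (p := p) (fun x : St p => μ (x.1, x.2.1 - 1, x.2.2)) (fun x : St p => μ (bx x.1 s, x.2.1 - 2, x.2.2 - 1))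
  rw [hf, hg] at this
  linarith

end Alien

/-! ## §2 The scheduled process -/

section Process

variable {n : ℕ} (p : ℕ) (y : Fin (n + 1) → (Fin n → Bool) → Bool) (τ : Fin n → Bool × Bool)

/-- the scheduled alien toggle consumed with bit `t`: `τ t` if the bit is `1` (nothing beyond position `n`). -/
def sched (u : Fin n → Bool) (t : ℕ) : Bool × Bool :=
  if h : t < n then (if u ⟨t, h⟩ then τ ⟨t, h⟩ else (false, false)) else (false, false)

/-- the register BEFORE cut `t`: fires toggle at the label (as in `regN`), and bit `t−1` has applied its schedule. -/
noncomputable def regT (u : Fin n → Bool) : ℕ → Bool × Bool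
  | 0 => (false, false)
  | t + 1 => bx (if firedN p y u t then tog (labN u t) (regT u t) else regT u t) (sched τ u t)

/-- the register AFTER the fire decision of cut `t` (before bit `t`). -/
noncomputable def regTp (u : Fin n → Bool) (t : ℕ) : Bool × Bool :=
  if firedN p y u t then tog (labN u t) (regT p y τ u t) else regT p y τ u t

/-- CharDialSchedCounterSubcubeA helper `regT_succ` (decomp-qadv land package; see the module docstring). -/
theorem regT_succ (u : Fin n → Bool) (t : ℕ) : regT p y τ u (t + 1) = bx (regTp p y τ u t) (sched τ u t) := rfl

/-- the state before cut `t`. -/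
noncomputable def XT (u : Fin n → Bool) (t : ℕ) : St p := (regT p y τ u t, labN u t, ctrN p u t)

/-- the state after the fire decision of cut `t`. -/
noncomputable def XTp (u : Fin n → Bool) (t : ℕ) : St p := (regTp p y τ u t, labN u t, ctrN p u t)

/-- CharDialSchedCounterSubcubeA helper `XTp_eq` (decomp-qadv land package; see the module docstring). -/
theorem XTp_eq (u : Fin n → Bool) (t : ℕ) : XTp p y τ u t = fireMap p y t (XT p y τ u t) := rfl

/-- CharDialSchedCounterSubcubeA helper `XT_zero` (decomp-qadv land package; see the module docstring). -/
theorem XT_zero (u : Fin n → Bool) : XT p y τ u 0 = ((false, false), 0, 0) := by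
  have h := X_zero p y u
  simp only [X, Prod.mk.injEq] at h
  simp only [XT, regT, h.2.1, h.2.2]

/-- **the scheduled bit step**: `XT u (t+1) = togSt (sched) (bitEq (u t) (XTp u t))`. -/
theorem XT_succ (u : Fin n → Bool) (t : Fin n) :
    XT p y τ u (t.val + 1) = togSt p (if u t then τ t else (false, false)) (bitEq p (u t) (XTp p y τ u t.val)) := by
  have h := X_succ p y u t
  simp only [X, Xp, bitEq_apply, Prod.mk.injEq] at h
  simp only [XT, XTp, togSt_apply, bitEq_apply, Prod.mk.injEq, regT_succ, sched, dif_pos t.isLt, Fin.eta]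
  exact ⟨trivial, h.2.1, h.2.2⟩

/-- adaptedness of the register: `regT u t` reads only bits `< t`. -/
theorem regT_update (u : Fin n → Bool) (i : Fin n) (β : Bool) : ∀ {t : ℕ}, t ≤ i.val →
    regT p y τ (Function.update u i β) t = regT p y τ u t
  | 0, _ => rfl
  | t + 1, ht => by
    have ht' : t ≤ i.val := by omega
    have hti : t < n := by omega
    have hne : (⟨t, hti⟩ : Fin n) ≠ i := fun h => by rw [Fin.ext_iff] at h; simp at h; omega
    simp only [regT, firedN, ctrN, labN, wtPrefix_update_of_le u i β ht', regT_update u i β ht', sched, dif_pos hti,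
      Function.update_of_ne hne]

/-- **adaptedness**: the state after cut `t`'s decision reads only bits `< t`. -/
theorem XTp_update (u : Fin n → Bool) (i : Fin n) (β : Bool) {t : ℕ} (ht : t ≤ i.val) :
    XTp p y τ (Function.update u i β) t = XTp p y τ u t := by
  simp only [XTp, regTp, firedN, labN, ctrN, wtPrefix_update_of_le u i β ht, regT_update p y τ u i β ht]

end Process

/-! ## §3 Laws on a subcube and their recursion -/

section SubProcess

variable {n : ℕ} (p : ℕ) (y : Fin (n + 1) → (Fin n → Bool) → Bool) (τ : Fin n → Bool × Bool)
  (W : Finset (Fin n)) (b : Fin n → Bool)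

/-- law of the state before cut `t` over the subcube (each point counted `2^{|W|}` times). -/
noncomputable def lawT (t : ℕ) (x : St p) : ℝ :=
  ((univ.filter fun u : Fin n → Bool => XT p y τ (subcubeMerge W b u) t = x).card : ℝ)

/-- law of the state after cut `t` over the subcube. -/
noncomputable def lawTp (t : ℕ) (x : St p) : ℝ :=
  ((univ.filter fun u : Fin n → Bool => XTp p y τ (subcubeMerge W b u) t = x).card : ℝ)

/-- CharDialSchedCounterSubcubeA helper `lawT_nonneg` (decomp-qadv land package; see the module docstring). -/
theorem lawT_nonneg (t : ℕ) (x : St p) : 0 ≤ lawT p y τ W b t x := Nat.cast_nonneg _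

/-- CharDialSchedCounterSubcubeA helper `lawTp_nonneg` (decomp-qadv land package; see the module docstring). -/
theorem lawTp_nonneg (t : ℕ) (x : St p) : 0 ≤ lawTp p y τ W b t x := Nat.cast_nonneg _

/-- fire step: `lawTp t = lawT t ∘ fireMap t`. -/
theorem lawTp_eq (t : ℕ) (x : St p) : lawTp p y τ W b t x = lawT p y τ W b t (fireMap p y t x) := by
  unfold lawTp lawT
  congr 2
  ext u
  simp only [mem_filter, mem_univ, true_and, XTp_eq]
  constructor
  · intro h; rw [← h, fireMap_fireMap]
  · intro h; rw [h, fireMap_fireMap]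


end SubProcess
end CounterLaw
end Summit.QuantumAdvantage.AdviceFreeQNC0
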